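import Summits.CriticalPhenomena.SAWScalingLimit.Theses.SAWDefectDecoherence
import HarnessLib

/-!
# Route `SAWDefectDecoherence`, crux `BoundaryClosureR` (stmt-CriticalPhenomena-14004), line
# `polygon-parity-squeeze`: vocabulary (definitions file, reviewed)

Definitions file for the OBJECTS and PREDICATES that the line `polygon-parity-squeeze` (skeleton
`Cruxes/BoundaryClosureR/Lines/polygon_parity_squeeze.lean`, strategist 2026-08-17, lead c6) and its
helper files use, so that the registered stubs of the line can be landed under `Theorems/` with
short headers.  Every `def` below has parameters (a datum, a family, a point, a radius); the line's
closed statements (`GateL1Root`, `PolygonPackage`, `PolygonGateProfile`, `GateCollarAvoidance`,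
`GateData`, …) are universal closures of these predicates and live in the skeleton only — NOTHING is
asserted here, and neither the crux `BoundaryClosureR` nor the target `HexObservableLimitR` is
restated.  Precedent: `Theorems/SAWDefectDecoherencePickHalfPlaneDefs.lean`.

Contents.
1. Frames of the target (verbatim from the r15 skeleton `Lines/pick_half_plane.lean` /
   `TwoRootQuotient`): the normalised bulk functional `NF`, bulk tests `IsTest`, `AdmissibleFamily`
   (rigid half-lattice ball at the normaliser `pt 1`, admissibility, exhaustion), `PinnedFlatRoot`
   (rigid half-lattice ball at a root), `IsWeakLimit`; the predicate `L1BoundOn` (eventually bounded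
   `b`-normalised `L¹` mass over a set) in which the certificate's input [I] `LocalL1Root` and the
   line's `GateL1Root` are written, and `HasGateTrace c D ρ Λ a b` in which [II] `GateTraceH` is
   written (`GateTraceH = ∃ c ≠ 0, ∀ data, HasGateTrace c …`).
2. Gate frames shared with line `runge-gated-green-pairing`: `gateSeg`, `ConformalFrame`.
3. Exact-sided lattice polygons: the six zigzag half-lattice forms `zigzagForm`, their inner normals
   `innerNormal`, `halfPlane`, `IsFlatSideAt`, `IsCornerAt`, `ExactPolygonFamily`.
4. Per-datum forms of the line's statements: `RootTightAt` (root tightness), `starMass`,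
   `IsMetricDepth`, `BoundaryLayerBudgetAt`, `GateLayerBudgetAt`, `RatioMixingAt`, `GateProfileAt`
   (gate arrival profile law on a gate ball of given radius), `collarDomain` / `CollarAvoidanceAt`.

Sources: H. Duminil-Copin, S. Smirnov, Ann. of Math. 175 (2012) (arXiv:1007.0575) §2–§3 (domains,
observable, boundary winding) and Conjecture 2; G. Lawler, O. Schramm, W. Werner, *On the scaling
limit of planar self-avoiding walk* (2004) §3.4 (restriction); the line card
`Cruxes/BoundaryClosureR/Lines/polygon-parity-squeeze.md` and `Cruxes/BoundaryClosureR/STRATEGY-CENSUS.md`.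
Deliberately NOT here: any closed statement (model input or conclusion) of the line.
-/

noncomputable section

open scoped BigOperators ComplexConjugate Topology Classical
open Filter Set MeasureTheory
open Literature.Probability.LatticeModels Literature.Probability.RandomPlanarGeometry
open Literature.Probability.RandomPlanarGeometry.SAW

namespace Summit.CriticalPhenomena.SAWScalingLimit.Theorems.PolygonParitySqueeze

/-! ### 1. Frames of the target -/

/-- The normalised functional `N^{e}_δ(ψ) := δ² Σ_{z ∈ Ω_δ} ψ(δ·mid z) F^{e δ}(z) / F^{e δ}(b δ)`
(root family `e`, normalisation family `b`, spin `5/8`, fugacity `x_c`).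
[cite: DuminilCopinSmirnov2012, Conjecture 2 (normalised observable)] -/
def NF (Λ : ℝ → Finset HexVertex) (e b : ℝ → Sym2 HexVertex) (δ : ℝ) (ψ : ℂ → ℂ) : ℂ :=
  (δ : ℂ) ^ 2 * (∑ᶠ z ∈ hexDomainMidEdges (Λ δ),
      ψ ((δ : ℂ) * hexMidpoint z) * hexParafermionicObservable (Λ δ) (e δ) hexCriticalFugacity (5 / 8) z) /
    hexParafermionicObservable (Λ δ) (e δ) hexCriticalFugacity (5 / 8) (b δ)

/-- Bulk test functions of the target: continuous, compactly supported inside the domain. [folklore] -/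
def IsTest (D : DobrushinDomain) (ψ : ℂ → ℂ) : Prop :=
  Continuous ψ ∧ HasCompactSupport ψ ∧ tsupport ψ ⊆ D.carrier

/-- The root-free part of the target's hypotheses: flat piece and exact half-lattice around the
normalisation point `D.pt 1`, eventual admissibility of `Λ δ`, exhaustion of compacts, `b δ → pt 1`.
(Verbatim `TwoRootQuotient.AdmissibleFamily` of the r15 skeleton.)
[cite: DuminilCopinSmirnov2012, §2 (domains) and Conjecture 2] -/
def AdmissibleFamily (D : DobrushinDomain) (ρ : ℝ) (Λ : ℝ → Finset HexVertex) (m : ℝ → ℤ)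
    (b : ℝ → Sym2 HexVertex) : Prop :=
  0 < ρ ∧
  D.carrier ∩ Metric.ball (D.pt 1) ρ = {z : ℂ | (D.pt 1).im < z.im} ∩ Metric.ball (D.pt 1) ρ ∧
  (∀ᶠ δ : ℝ in 𝓝[>] 0, hexDomainSimplyConnected (Λ δ) ∧ b δ ∈ hexDomainBoundary (Λ δ) ∧
      (hexGraph.induce ((Λ δ : Finset HexVertex) : Set HexVertex)).Preconnected ∧
      (∀ v ∈ Λ δ, (δ : ℂ) * hexCenter v ∈ D.carrier) ∧
      (∀ v : HexVertex, (δ : ℂ) * hexCenter v ∈ Metric.ball (D.pt 1) ρ → (v ∈ Λ δ ↔ m δ ≤ v.1 1))) ∧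
  (∀ K : Set ℂ, IsCompact K → K ⊆ D.carrier →
      ∀ᶠ δ : ℝ in 𝓝[>] 0, ∀ v : HexVertex, (δ : ℂ) * hexCenter v ∈ K → v ∈ Λ δ) ∧
  Tendsto (fun δ : ℝ => (δ : ℂ) * hexMidpoint (b δ)) (𝓝[>] 0) (𝓝 (D.pt 1))

/-- A root family `e` PINNED on a flat piece at `x ∈ ∂D`: inside `ball x r` the domain is the open
half-plane above `x` and `Λ δ` is exactly the half-lattice `{v | mr δ ≤ v.1 1}`; the roots are
boundary mid-edges with `δ·mid(e δ) → x`, and walks to the normaliser exist.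
(Verbatim `TwoRootQuotient.PinnedFlatRoot` of the r15 skeleton.)
[cite: DuminilCopinSmirnov2012, §2 (boundary mid-edges, winding)] -/
def PinnedFlatRoot (D : DobrushinDomain) (Λ : ℝ → Finset HexVertex) (b : ℝ → Sym2 HexVertex)
    (x : ℂ) (e : ℝ → Sym2 HexVertex) (r : ℝ) (mr : ℝ → ℤ) : Prop :=
  0 < r ∧
  D.carrier ∩ Metric.ball x r = {z : ℂ | x.im < z.im} ∩ Metric.ball x r ∧
  (∀ᶠ δ : ℝ in 𝓝[>] 0, e δ ∈ hexDomainBoundary (Λ δ) ∧ Nonempty (HexMidEdgeSAW (Λ δ) (e δ) (b δ)) ∧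
      (∀ v : HexVertex, (δ : ℂ) * hexCenter v ∈ Metric.ball x r → (v ∈ Λ δ ↔ mr δ ≤ v.1 1))) ∧
  Tendsto (fun δ : ℝ => (δ : ℂ) * hexMidpoint (e δ)) (𝓝[>] 0) (𝓝 x)

/-- `g` is the weak limit of the normalised functionals of root family `e` along the mesh sequence
`ns`: `N^{e}_{ns n}(ψ) → ∫ ψ g` for every bulk test function. (Verbatim `TwoRootQuotient.IsWeakLimit`.)
[folklore] -/
def IsWeakLimit (D : DobrushinDomain) (Λ : ℝ → Finset HexVertex) (e b : ℝ → Sym2 HexVertex)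
    (ns : ℕ → ℝ) (g : ℂ → ℂ) : Prop :=
  ∀ ψ : ℂ → ℂ, IsTest D ψ → Tendsto (fun n => NF Λ e b (ns n) ψ) atTop (𝓝 (∫ z, ψ z * g z))

/-- **Eventually bounded normalised `L¹` mass over a set**: for the family `Λ` with roots `a` and
normalisers `b`, the `b`-normalised `L¹` mass of the observable over the mid-edges `z` with
`δ·mid z ∈ S` is eventually bounded, `δ² Σ_{δ·mid z ∈ S} ‖F_δ(z)‖ ≤ C ‖F_δ(b δ)‖`.  The certificate's
input [I] `LocalL1Root` is this for every compact `S ⊆ Ω`; the line's `GateL1Root` for every compact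
`S ⊆ Ω ∪ gate` avoiding the root. [cite: DuminilCopinSmirnov2012, Conjecture 2 (normalised observable)] -/
def L1BoundOn (Λ : ℝ → Finset HexVertex) (a b : ℝ → Sym2 HexVertex) (S : Set ℂ) : Prop :=
  ∃ C : ℝ, ∀ᶠ δ : ℝ in 𝓝[>] 0,
    δ ^ 2 * (∑ᶠ z ∈ {z : Sym2 HexVertex | z ∈ hexDomainMidEdges (Λ δ) ∧ (δ : ℂ) * hexMidpoint z ∈ S},
        ‖hexParafermionicObservable (Λ δ) (a δ) hexCriticalFugacity (5 / 8) z‖) ≤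
      C * ‖hexParafermionicObservable (Λ δ) (a δ) hexCriticalFugacity (5 / 8) (b δ)‖

/-- **Gate trace with constant `c` for one datum**: for every admissible conformal datum `(Φ, L, L_b)`
of `D` (`Φ : Ω → ℍ`, `a = pt 0 ↦ ∞`, `b = pt 1 ↦ 0`, `L` a continuous logarithm of `Φ'` with limit
`L_b` at `b`), every mesh sequence `ns → 0⁺` and every function `g` HOLOMORPHIC on the carrier that is
the weak limit of the normalised functionals of the family `(Λ, a, b)` along `ns`,
`g · exp(−(5/8)(L − L_b)) → c` within the carrier at every point of the flat gate of radius `ρ`.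
The certificate's input [II] `GateTraceH` is `∃ c ≠ 0, ∀ admissible pinned data, HasGateTrace c …`.
[cite: DuminilCopinSmirnov2012, Conjecture 2 (identification on the gate)] -/
def HasGateTrace (c : ℂ) (D : DobrushinDomain) (ρ : ℝ) (Λ : ℝ → Finset HexVertex)
    (a b : ℝ → Sym2 HexVertex) : Prop :=
  ∀ (Φ : ConformalEquiv D.carrier UpperHalfPlane.upperHalfPlaneSet) (L : ℂ → ℂ) (Lb : ℂ),
    Tendsto (fun z => ‖Φ z‖) (𝓝[D.carrier] (D.pt 0)) atTop → Φ.HasBoundaryValue (D.pt 1) 0 →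
    ContinuousOn L D.carrier → (∀ z ∈ D.carrier, Complex.exp (L z) = deriv Φ z) →
    Tendsto L (𝓝[D.carrier] (D.pt 1)) (𝓝 Lb) →
  ∀ ns : ℕ → ℝ, Tendsto ns atTop (𝓝[>] 0) →
  ∀ g : ℂ → ℂ, DifferentiableOn ℂ g D.carrier → IsWeakLimit D Λ a b ns g →
    ∀ y : ℂ, y.im = (D.pt 1).im → y ∈ Metric.ball (D.pt 1) ρ →
      Tendsto (fun z => g z * Complex.exp (-((5 / 8 : ℂ) * (L z - Lb)))) (𝓝[D.carrier] y) (𝓝 c)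

/-! ### 2. Gate frames (shared with line `runge-gated-green-pairing`) -/

/-- The flat GATE at the normalisation point: the horizontal segment through `pt 1` of radius `r`.
[folklore] -/
def gateSeg (D : DobrushinDomain) (r : ℝ) : Set ℂ :=
  {z : ℂ | z.im = (D.pt 1).im} ∩ Metric.ball (D.pt 1) r

/-- The conformal frame of the target: `Φ : Ω → ℍ` with `a ↦ ∞`, `b ↦ 0`, `L` a continuous logarithm
of `Φ'` with limit `Lb` at `b`. [folklore] -/
def ConformalFrame (D : DobrushinDomain)
    (Φ : ConformalEquiv D.carrier UpperHalfPlane.upperHalfPlaneSet) (L : ℂ → ℂ) (Lb : ℂ) : Prop :=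
  Tendsto (fun x => ‖Φ x‖) (𝓝[D.carrier] (D.pt 0)) atTop ∧ Φ.HasBoundaryValue (D.pt 1) 0 ∧
  ContinuousOn L D.carrier ∧ (∀ z ∈ D.carrier, Complex.exp (L z) = deriv Φ z) ∧
  Tendsto L (𝓝[D.carrier] (D.pt 1)) (𝓝 Lb)

/-! ### 3. Exact-sided lattice polygons -/

/-- The six EXACT ZIGZAG HALF-LATTICE forms on faces `v = (cell, type)` of `ℍ`: `{v | n ≤ zigzagForm k v}`
is, for every threshold `n`, a half-lattice bounded by a zigzag line (directions 0°, 0°, 60°, 60°, 120°,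
120°) all of whose dangling boundary edges are parallel (ONE lattice class: outward directions −90°,
+90°, 150°, −30°, −150°, +30° respectively; checked on the embedded lattice `hexCenter`).  Form `0` is
the target's own `{v | m ≤ v.1 1}`. [folklore] -/
def zigzagForm : Fin 6 → HexVertex → ℤ :=
  ![fun v => v.1 1, fun v => -(v.1 1), fun v => v.1 0, fun v => -(v.1 0),
    fun v => v.1 0 + v.1 1 + ((v.2 : ℕ) : ℤ), fun v => -(v.1 0 + v.1 1 + ((v.2 : ℕ) : ℤ))]

/-- The inner unit normals of the six half-planes matching `zigzagForm` (the form is a monotone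
function of `Re((hexCenter v)·conj n_k)`): `i, −i, e^{−iπ/6}, −e^{−iπ/6}, e^{iπ/6}, −e^{iπ/6}`.
[folklore] -/
def innerNormal : Fin 6 → ℂ :=
  ![Complex.I, -Complex.I, Complex.exp (-((Real.pi / 6 : ℝ) : ℂ) * Complex.I),
    -Complex.exp (-((Real.pi / 6 : ℝ) : ℂ) * Complex.I), Complex.exp (((Real.pi / 6 : ℝ) : ℂ) * Complex.I),
    -Complex.exp (((Real.pi / 6 : ℝ) : ℂ) * Complex.I)]

/-- The open half-plane through `z` with inner normal `innerNormal k`. [folklore] -/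
def halfPlane (k : Fin 6) (z : ℂ) : Set ℂ :=
  {w : ℂ | 0 < ((w - z) * (starRingEnd ℂ) (innerNormal k)).re}

/-- FLAT SIDE at the boundary point `z`, radius `r`, mesh `δ`: inside `ball z r` the domain is a
zigzag-direction half-plane through `z` and `Λ` is an EXACT half-lattice of the matching form.
[folklore] -/
def IsFlatSideAt (D : DobrushinDomain) (Λ : Finset HexVertex) (δ : ℝ) (z : ℂ) (r : ℝ) : Prop :=
  ∃ (k : Fin 6) (n : ℤ), D.carrier ∩ Metric.ball z r = halfPlane k z ∩ Metric.ball z r ∧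
    ∀ v : HexVertex, (δ : ℂ) * hexCenter v ∈ Metric.ball z r → (v ∈ Λ ↔ n ≤ zigzagForm k v)

/-- LATTICE CORNER at `z`: inside `ball z r` the domain is the intersection (convex corner, 60°/120°)
or the union (reflex corner, 240°/300°) of two zigzag-direction half-planes through `z`, and `Λ` is
the intersection resp. union of the two matching exact half-lattices. [folklore] -/
def IsCornerAt (D : DobrushinDomain) (Λ : Finset HexVertex) (δ : ℝ) (z : ℂ) (r : ℝ) : Prop :=
  ∃ (k k' : Fin 6) (n n' : ℤ),
    (D.carrier ∩ Metric.ball z r = halfPlane k z ∩ halfPlane k' z ∩ Metric.ball z r ∧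
      ∀ v : HexVertex, (δ : ℂ) * hexCenter v ∈ Metric.ball z r →
        (v ∈ Λ ↔ (n ≤ zigzagForm k v ∧ n' ≤ zigzagForm k' v))) ∨
    (D.carrier ∩ Metric.ball z r = (halfPlane k z ∪ halfPlane k' z) ∩ Metric.ball z r ∧
      ∀ v : HexVertex, (δ : ℂ) * hexCenter v ∈ Metric.ball z r →
        (v ∈ Λ ↔ (n ≤ zigzagForm k v ∨ n' ≤ zigzagForm k' v)))

/-- **EXACT POLYGON FAMILY**: finitely many corners on `∂Ω`, at distance `≥ r` from both marked points;
eventually in `δ`, every boundary point at distance `≥ r` from the corners is a flat side point of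
radius `r/2` (half radius: at a 60° corner the `r`-ball about a side point at distance `r` from the
corner meets the adjacent side) and every corner is a lattice corner of radius `r`.  The TAME
carriers of the line: every boundary mid-edge of `Λ_δ` hangs from an exact zigzag row, with ONE rigid
phase per side and a POSITIVE arrival mass. [folklore] -/
def ExactPolygonFamily (D : DobrushinDomain) (Λ : ℝ → Finset HexVertex) : Prop :=
  ∃ (corners : Finset ℂ) (r : ℝ), 0 < r ∧ (↑corners : Set ℂ) ⊆ frontier D.carrier ∧
    (∀ i : Fin 2, ∀ c ∈ corners, r ≤ dist (D.pt i) c) ∧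
    ∀ᶠ δ : ℝ in 𝓝[>] 0, ∀ z ∈ frontier D.carrier,
      ((∀ c ∈ corners, r ≤ dist z c) → IsFlatSideAt D (Λ δ) δ z (r / 2)) ∧
      (z ∈ corners → IsCornerAt D (Λ δ) δ z r)

/-! ### 4. Per-datum forms of the line's statements -/

/-- **Root tightness** of the family `(Λ, a, b)` at the point `x`:
`lim_{r→0} limsup_δ δ² Σ_{δ·mid z ∈ B(x,r)} ‖F_δ(z)‖ / ‖F_δ(b_δ)‖ = 0` (predicted `≍ r^{3/4}` at the
root, where `|F| ≍ δ^{5/4}|z−a|^{-5/4}`).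
[cite: DuminilCopinSmirnov2012, Conjecture 2 (normalised observable)] -/
def RootTightAt (Λ : ℝ → Finset HexVertex) (a b : ℝ → Sym2 HexVertex) (x : ℂ) : Prop :=
  ∀ ε : ℝ, 0 < ε → ∃ r : ℝ, 0 < r ∧ ∀ᶠ δ : ℝ in 𝓝[>] 0,
    δ ^ 2 * (∑ᶠ z ∈ {z : Sym2 HexVertex | z ∈ hexDomainMidEdges (Λ δ) ∧
          (δ : ℂ) * hexMidpoint z ∈ Metric.ball x r},
        ‖hexParafermionicObservable (Λ δ) (a δ) hexCriticalFugacity (5 / 8) z‖) ≤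
      ε * ‖hexParafermionicObservable (Λ δ) (a δ) hexCriticalFugacity (5 / 8) (b δ)‖

/-- The `σ = 0` STAR MASS at a vertex `v` of the domain `Λ` rooted at `a`: the sum of the critical
arrival masses `Z(a → {v,t})` over the neighbours `t ∈ Λ` of `v`.
[cite: DuminilCopinSmirnov2012, Def. 1 (σ = 0)] -/
def starMass (Λ : Finset HexVertex) (a : Sym2 HexVertex) (v : HexVertex) : ℝ :=
  ∑ t ∈ Λ.filter (fun t => hexGraph.Adj v t), ‖hexParafermionicObservable Λ a hexCriticalFugacity 0 s(v, t)‖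

/-- `v` has METRIC DEPTH `k` in `Λ`: every face with centre within distance `k` of `c_v` lies in `Λ`,
but not every face within distance `k + 1` (lattice units, embedded centres). [folklore] -/
def IsMetricDepth (Λ : Finset HexVertex) (v : HexVertex) (k : ℕ) : Prop :=
  (∀ y : HexVertex, dist (hexCenter y) (hexCenter v) ≤ k → y ∈ Λ) ∧
    ¬ (∀ y : HexVertex, dist (hexCenter y) (hexCenter v) ≤ (k : ℝ) + 1 → y ∈ Λ)

/-- **Boundary layer budget at a boundary point `z`** (positive masses): for some ball `B(z, r)` and
constant `C`, eventually in `δ`, for every depth `k` the star masses of the depth-`k` vertices with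
scaled centre in the ball satisfy `δ Σ starMass ≤ C (k+1)^{3/4} Z_δ(b_δ)` (predicted `(k+1)^{25/48}`;
only the route's cut `3/4` is consumed).
[cite: LawlerSchrammWerner2004SAW, §3.4 (restriction / boundary scaling heuristics)] -/
def BoundaryLayerBudgetAt (Λ : ℝ → Finset HexVertex) (a b : ℝ → Sym2 HexVertex) (z : ℂ) : Prop :=
  ∃ r C : ℝ, 0 < r ∧ ∀ᶠ δ : ℝ in 𝓝[>] 0, ∀ k : ℕ,
    δ * (∑ᶠ v ∈ {v : HexVertex | v ∈ Λ δ ∧ (δ : ℂ) * hexCenter v ∈ Metric.ball z r ∧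
          IsMetricDepth (Λ δ) v k}, starMass (Λ δ) (a δ) v) ≤
      C * ((k : ℝ) + 1) ^ (3 / 4 : ℝ) * ‖hexParafermionicObservable (Λ δ) (a δ) hexCriticalFugacity 0 (b δ)‖

/-- **Gate layer budget on the gate ball of radius `r`** (positive masses; depth = row above the gate
row `m δ`): eventually `δ Σ_{v : row m δ + k, δ c_v ∈ B(pt 1, r)} starMass ≤ C (k+1)^{3/4} Z_δ(b_δ)`
for every `k`. [cite: LawlerSchrammWerner2004SAW, §3.4 (restriction / boundary scaling heuristics)] -/
def GateLayerBudgetAt (D : DobrushinDomain) (r : ℝ) (Λ : ℝ → Finset HexVertex) (m : ℝ → ℤ)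
    (a b : ℝ → Sym2 HexVertex) : Prop :=
  ∃ C : ℝ, ∀ᶠ δ : ℝ in 𝓝[>] 0, ∀ k : ℕ,
    δ * (∑ᶠ v ∈ {v : HexVertex | v ∈ Λ δ ∧ (δ : ℂ) * hexCenter v ∈ Metric.ball (D.pt 1) r ∧
          v.1 1 = m δ + k}, starMass (Λ δ) (a δ) v) ≤
      C * ((k : ℝ) + 1) ^ (3 / 4 : ℝ) * ‖hexParafermionicObservable (Λ δ) (a δ) hexCriticalFugacity 0 (b δ)‖

/-- **Averaged ratio mixing at the normaliser** (positive masses, qualitative): the boundary arrivals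
in a macroscopic window of half-width `s` around `b_δ`, averaged with the gate spacing `δ`, are
asymptotic to the arrival at `b_δ` itself as `s → 0` after `δ → 0`.
[cite: LawlerSchrammWerner2004SAW, §3.4 (restriction / boundary scaling heuristics)] -/
def RatioMixingAt (Λ : ℝ → Finset HexVertex) (a b : ℝ → Sym2 HexVertex) : Prop :=
  ∀ ε : ℝ, 0 < ε → ∃ s₀ : ℝ, 0 < s₀ ∧ ∀ s : ℝ, 0 < s → s < s₀ → ∀ᶠ δ : ℝ in 𝓝[>] 0,
    |δ / (2 * s) * (∑ᶠ e ∈ {e : Sym2 HexVertex | e ∈ hexDomainBoundary (Λ δ) ∧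
          (δ : ℂ) * hexMidpoint e ∈ Metric.ball ((δ : ℂ) * hexMidpoint (b δ)) s},
        ‖hexParafermionicObservable (Λ δ) (a δ) hexCriticalFugacity 0 e‖ /
          ‖hexParafermionicObservable (Λ δ) (a δ) hexCriticalFugacity 0 (b δ)‖) - 1| ≤ ε

/-- **Gate arrival profile law on the gate ball of radius `r`**: for every conformal frame
`(Φ, L, L_b)` of `D` and every continuous extension `L̄` of `L` to the gate segment of radius `ρ`, the
`b`-normalised positive gate arrival measure on `B(pt 1, r)` converges, as `δ → 0⁺`, to the conformal
density `exp((5/8)(L̄ − L_b)) dx = (Φ'/Φ'(b))^{5/8} dx` on the gate.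
[cite: DuminilCopinSmirnov2012, Conjecture 2 (boundary shadow on the gate)] -/
def GateProfileAt (D : DobrushinDomain) (ρ r : ℝ) (Λ : ℝ → Finset HexVertex)
    (a b : ℝ → Sym2 HexVertex) : Prop :=
  ∀ (Φ : ConformalEquiv D.carrier UpperHalfPlane.upperHalfPlaneSet) (L : ℂ → ℂ) (Lb : ℂ),
    ConformalFrame D Φ L Lb →
  ∀ (Lbar : ℂ → ℂ), ContinuousOn Lbar (D.carrier ∪ gateSeg D ρ) → EqOn Lbar L D.carrier →
  ∀ (g : ℂ → ℂ), Continuous g → HasCompactSupport g → tsupport g ⊆ Metric.ball (D.pt 1) r →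
    Tendsto (fun δ : ℝ => (δ : ℂ) *
        ∑ᶠ e ∈ {e : Sym2 HexVertex | e ∈ hexDomainBoundary (Λ δ) ∧
            (δ : ℂ) * hexMidpoint e ∈ Metric.ball (D.pt 1) r},
          g ((δ : ℂ) * hexMidpoint e) *
            (hexParafermionicObservable (Λ δ) (a δ) hexCriticalFugacity 0 e /
              hexParafermionicObservable (Λ δ) (a δ) hexCriticalFugacity 0 (b δ)))
      (𝓝[>] 0)
      (𝓝 (∫ x in Set.Ioo ((D.pt 1).re - r) ((D.pt 1).re + r),
        g ((x : ℂ) + ((D.pt 1).im : ℂ) * Complex.I) *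
          Complex.exp ((5 / 8 : ℂ) * (Lbar ((x : ℂ) + ((D.pt 1).im : ℂ) * Complex.I) - Lb))))

/-- The COLLAR-DELETED domain: keep the vertices of `Λ` whose scaled centre is at distance `≥ η` from
`ℂ ∖ Ω`, or lies in one of the two pinned balls `B(pt 0, r₀)`, `B(pt 1, ρ)`. [folklore] -/
def collarDomain (D : DobrushinDomain) (ρ r₀ η δ : ℝ) (Λ : Finset HexVertex) : Finset HexVertex :=
  Λ.filter fun v =>
    η ≤ Metric.infDist ((δ : ℂ) * hexCenter v) D.carrierᶜ ∨
    (δ : ℂ) * hexCenter v ∈ Metric.ball (D.pt 0) r₀ ∨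
    (δ : ℂ) * hexCenter v ∈ Metric.ball (D.pt 1) ρ

/-- **Gate collar avoidance for one family** (positive masses, qualitative): for every `ε > 0` there is
a macroscopic `η > 0` such that eventually, for every mid-edge `z` with `δ·mid z` in the gate half-ball
`B(pt 1, ρ/2)`, deleting the `η`-collar (outside the pinned balls) keeps at least `(1−ε)` of the
`σ = 0` mass `Z_δ(a_δ → z)`. (Restriction heuristics: `P(hit the η-collar) = O(η)`.)
[cite: LawlerSchrammWerner2004SAW, §3.4 (restriction / boundary scaling heuristics)] -/
def CollarAvoidanceAt (D : DobrushinDomain) (ρ : ℝ) (Λ : ℝ → Finset HexVertex)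
    (a : ℝ → Sym2 HexVertex) (r₀ : ℝ) : Prop :=
  ∀ ε : ℝ, 0 < ε → ∃ η : ℝ, 0 < η ∧ ∀ᶠ δ : ℝ in 𝓝[>] 0, ∀ z ∈ hexDomainMidEdges (Λ δ),
    (δ : ℂ) * hexMidpoint z ∈ Metric.ball (D.pt 1) (ρ / 2) →
    (1 - ε) * ‖hexParafermionicObservable (Λ δ) (a δ) hexCriticalFugacity 0 z‖ ≤
      ‖hexParafermionicObservable (collarDomain D ρ r₀ η δ (Λ δ)) (a δ) hexCriticalFugacity 0 z‖

/-! ### 5. Elementary API -/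

/-- The collar-deleted domain is a sub-domain: `collarDomain D ρ r₀ η δ Λ ⊆ Λ` (it is a `Finset.filter`
of `Λ`); with domain monotonicity of the `σ = 0` masses this gives the upper half of the squeeze
sandwich `Z_{Λ ∖ collar} ≤ Z_{Λ^P} ≤ Z_Λ`. [folklore] -/
theorem collarDomain_subset : ∀ (D : DobrushinDomain) (ρ r₀ η δ : ℝ) (Λ : Finset HexVertex), collarDomain D ρ r₀ η δ Λ ⊆ Λ :=
  fun _ _ _ _ _ _ => Finset.filter_subset _ _

end Summit.CriticalPhenomena.SAWScalingLimit.Theorems.PolygonParitySqueeze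

end
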